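import Literature.Barriers.BirchSwinnertonDyer.RankNotSumOfLocalInvariantsF5Conductor2651Descent
import Literature.NumberTheory.NumberFields.CyclicQuinticField2651K1
import Literature.NumberTheory.NumberFields.CyclicQuinticField2651K2
import Literature.NumberTheory.NumberFields.CyclicQuinticField2651K3
import Literature.NumberTheory.NumberFields.CyclicQuinticField2651K4
import Literature.NumberTheory.NumberFields.QuinticRing
import HarnessLib

/-!
# Barrier (BirchSwinnertonDyer), rank mod `5`: the four conductor-`2651` quintic fields located
  inside `F₅`, and the reduction of the last named fact to their abstract `2`-descents

Continuation of `RankNotSumOfLocalInvariantsF5Conductor2651Descent.lean` (libsplit-27), whose child named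
fact `DokchitserDokchitser2011_normDescent_480a1_quintic2651` — the norm-`1` `2`-descents of `E = 480a1`
over the quintic subfields `F₅^{⟨σ⟩}` of `F₅ ⊂ ℚ(ζ₂₆₅₁)` for the `σ ≠ 1` moving BOTH `θ11` and `θ241`,
i.e. over the four cyclic quintic fields of conductor `2651` — is all that remains of the `n = 5` witness
of Theorem 2 of T. Dokchitser–V. Dokchitser, *A note on the Mordell–Weil rank modulo `n`*, J. Number
Theory 131 (2011) 1833–1839 ("2-descent shows that `rk E/F₅ = 1` (e.g. using Magma, over all minimal
non-trivial subfields of `F_n`)"). The descents themselves are being carried out in the tree over the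
ABSTRACT fields `CyclicQuintic2651Kj.K = ℚ[X]/(f_j)`, `j = 1, …, 4`
(`NumberFields/CyclicQuinticField2651Kj*.lean`). This file PROVES the glue between the two — the
analogue, for conductor `2651`, of what `…F5NormDescentK11Proofs.lean` / `…K241Proofs.lean` do for the
conductors `11` and `241` — so that the child fact, hence `DokchitserDokchitser2011_rank_480a1_F5`,
follows in one line from the four abstract descent statements
(`DokchitserDokchitser2011_normDescent_480a1_quintic2651_of_normDescent_K`,
`DokchitserDokchitser2011_rank_480a1_F5_of_normDescent_K`). No named fact is introduced; the
hypotheses `h1, …, h4` are verbatim the shape of the tree's `CyclicQuintic241.normDescent`.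

* **Generators.** With `e_i = ζ₁₁^{2ⁱ} + ζ₁₁^{-2ⁱ}` (`ζ₁₁ = ζ²⁴¹`, `e₀ = θ11`, `i ∈ ℤ/5` since
  `2⁵ ≡ -1 (mod 11)`) and the Gaussian periods `f_k = Σ_{c ∈ C_k} ζ₂₄₁^c` of `241` (`ζ₂₄₁ = ζ¹¹`,
  `C_k = 7^{5ℤ+k}`, `f₀ = θ241`, the tree's `ind241 k`), put **`P_s = Σ_k e_{sk} f_k`** (`s ∈ (ℤ/5)ˣ`).
  `P_{j⁻¹} = Σᵢ e_i f_{ji}` is the orbit sum `g₀` of `CyclicQuinticField2651Kj.lean`, and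
  **`f_j(P_{j⁻¹}) = 0`** for its quintic `f_j` (`Pel_one_rel`, `Pel_three_rel` (`f₂`), `Pel_two_rel`
  (`f₃`), `Pel_four_rel`): an identity in the order of `F₅` with normal basis `e_i f_k`, which is made
  COMPUTABLE as `T = PeriodRing241 (ℤ[t]/(f₁₁))` — the tree's period ring of `241` (`PeriodRing241`)
  with coefficients in the tree's `QuinticRing ℤ (-1) (-3) 3 4 (-1) = ℤ[θ11]` — decided there by the
  kernel (`PT_one_rel`, …; `25`-dimensional, instant) and pushed to `K` through the evaluation
  `Φ : T →+* K` (`liftGen`: the universal property of `PeriodRing241 R` over any coefficient ring,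
  verbatim the tree's `PeriodRing241.lift`; `φ11 : ℤ[t]/(f₁₁) → K`, `t ↦ θ11`, `e_i ↦ e_i`).
* **Galois action.** `g ∈ Gal(K/ℚ)` with `g ζ = ζ^N`: `g e_i = e_{i+a}` for `N ≡ ±2^a (mod 11)`
  (`gal_e11`, a `55`-entry table) and `g f_k = f_{k+b}` for `N mod 241 ∈ C_b` (`gal_fper`, from
  `C_b · C_k = C_{k+b}`, a kernel check over the `25 · 48 · 48` products of coset members); fifth powers
  have `a = b = 0`, so `P_s ∈ F₅` (`Pel_mem_F5`), and `g P_s = P_s` whenever `s b = a` (`gal_Pel`).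
* **Location** (`F5.exists_PelF_fixed`): `σ ∈ Gal(F₅/ℚ)` lifts to some `g` (`F₅/ℚ` normal); `σ` moves
  `θ11 = c(1)` iff `a ≠ 0` and moves `θ241 = f₀` iff `b ≠ 0`; then `s = a b⁻¹ ≠ 0` and `σ` fixes `P_s`, so
  the quintic field `F₅^{⟨σ⟩}` (`F5.finrank_fixedField_zpowers`) contains a root of `f_{s⁻¹}` and is
  `ℚ`-isomorphic to `ℚ[X]/(f_{s⁻¹})` (`algEquivAdjoinRootOfRoot`), along which the descent statement is
  transported (`normDescent_transport`, verbatim the tree's `CyclicQuintic241.normDescent_of_algEquiv`).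

## References

* T. Dokchitser, V. Dokchitser, *A note on the Mordell–Weil rank modulo `n`*, J. Number Theory 131
  (2011) 1833–1839, arXiv:0910.4588: proof of Thm. 2 (p. 3 of the held arXiv copy: `F₅` = "the degree
  25 subfield of `ℚ(ζ₁₁, ζ₂₄₁)`", 2-descent "over all minimal non-trivial subfields").
  [DokchitserDokchitser2011RankModN]
* C. F. Gauss, *Disquisitiones Arithmeticae* (1801), art. 343–358 (periods, their products and the
  subfields of cyclotomic fields they generate). [folklore]
* J. H. Silverman, *The Arithmetic of Elliptic Curves*, 2nd ed., GTM 106 (2009): Prop. X.1.4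
  (complete `2`-descent). [SilvermanAEC2009]
-/

noncomputable section

open scoped NumberField

open NumberField WeierstrassCurve IntermediateField Finset Polynomial

namespace Literature.Barriers.BirchSwinnertonDyer

namespace DokchitserDokchitser2011

open Literature.NumberTheory.NumberFields Literature.NumberTheory.NumberFields.GaussianPeriod

/-! ### The computable order of `F₅`: the period ring of `241` over `ℤ[t]/(f₁₁)` -/

/-- **`R₁₁ = ℤ[t]/(t⁵ + t⁴ - 4t³ - 3t² + 3t + 1)`** (`t⁵ = -1 - 3t + 3t² + 4t³ - t⁴`), the order
`ℤ[ζ₁₁ + ζ₁₁⁻¹]`, as the tree's computable `QuinticRing`. [folklore] -/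
abbrev R11 : Type := QuinticRing ℤ (-1) (-3) 3 4 (-1)

/-- **`T = R₁₁ η₀ ⊕ ⋯ ⊕ R₁₁ η₄`**, the tree's computable period ring of conductor `241` with
coefficients in `R₁₁`: a computable model of the order `ℤ[ζ₁₁]⁺ ⊗ ℤ[η₀, …, η₄]` of `F₅` spanned by
the normal basis `(ζ₁₁^{2ⁱ} + ζ₁₁^{-2ⁱ}) η_k`. [folklore] -/
abbrev T25 : Type := PeriodRing241 R11

/-- **The five conjugates `e_i = t_{i}` of `t = ζ₁₁ + ζ₁₁⁻¹` in `R₁₁`** (`e₀ = t`,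
`e_{i+1} = e_i² - 2`, i.e. `e_i = ζ₁₁^{2ⁱ} + ζ₁₁^{-2ⁱ}`), as explicit quintuples. [folklore] -/
def eR : Fin 5 → R11
  | 0 => ⟨0, 1, 0, 0, 0⟩
  | 1 => ⟨-2, 0, 1, 0, 0⟩
  | 2 => ⟨2, 0, -4, 0, 1⟩
  | 3 => ⟨0, -3, 0, 1, 0⟩
  | 4 => ⟨-1, 2, 3, -1, -1⟩

/-- `e₀ = t`. [folklore] -/
theorem eR_zero : eR 0 = QuinticRing.gen ℤ (-1) (-3) 3 4 (-1) := rfl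

/-- **`e_{i+1} = e_i² - 2`** in `R₁₁` (indices modulo `5`: `e₄² - 2 = e₀` because `2⁵ ≡ -1 (mod 11)`).
[folklore] -/
theorem eR_succ (i : Fin 5) : eR (i + 1) = eR i * eR i - 2 := by
  fin_cases i <;> decide +kernel

/-- **The element `P_s = Σ_k e_{sk} η_k` of `T`** (`s ∈ (ℤ/5)ˣ`; for `s = j⁻¹` this is the orbit sum
`g₀ = Σᵢ e'ᵢ f_{ji}` of the tree's `CyclicQuinticField2651Kj.lean`). [folklore] -/
def PT (s : Fin 5) : T25 := ⟨eR (s * 0), eR (s * 1), eR (s * 2), eR (s * 3), eR (s * 4)⟩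

set_option maxRecDepth 100000 in
/-- **`P₁` is a root of `f₁ = X⁵ - X⁴ - 1060X³ + 8165X² + 42925X - 351649`** (the polynomial of
`CyclicQuinticField2651K1`), an identity in the computable order `T` decided by the kernel. [folklore] -/
theorem PT_one_rel : PT 1 ^ 5 - PT 1 ^ 4 - 1060 * PT 1 ^ 3 + 8165 * PT 1 ^ 2 + 42925 * PT 1 - 351649 = 0 := by
  decide +kernel

set_option maxRecDepth 100000 in
/-- **`P₃` is a root of `f₂ = X⁵ - X⁴ - 1060X³ - 18345X² - 105531X - 192589`** (the polynomial of
`CyclicQuinticField2651K2`; `3 = 2⁻¹` in `ℤ/5`). [folklore] -/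
theorem PT_three_rel :
    PT 3 ^ 5 - PT 3 ^ 4 - 1060 * PT 3 ^ 3 - 18345 * PT 3 ^ 2 - 105531 * PT 3 - 192589 = 0 := by
  decide +kernel

set_option maxRecDepth 100000 in
/-- **`P₂` is a root of `f₃ = X⁵ - X⁴ - 1060X³ - 7741X² + 106549X + 125531`** (the polynomial of
`CyclicQuinticField2651K3`; `2 = 3⁻¹` in `ℤ/5`). [folklore] -/
theorem PT_two_rel :
    PT 2 ^ 5 - PT 2 ^ 4 - 1060 * PT 2 ^ 3 - 7741 * PT 2 ^ 2 + 106549 * PT 2 + 125531 = 0 := by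
  decide +kernel

set_option maxRecDepth 100000 in
/-- **`P₄` is a root of `f₄ = X⁵ - X⁴ - 1060X³ + 18769X² - 105531X + 178551`** (the polynomial of
`CyclicQuinticField2651K4`; `4 = 4⁻¹` in `ℤ/5`). [folklore] -/
theorem PT_four_rel :
    PT 4 ^ 5 - PT 4 ^ 4 - 1060 * PT 4 ^ 3 + 18769 * PT 4 ^ 2 - 105531 * PT 4 + 178551 = 0 := by
  decide +kernel

/-! ### A universal property of the period ring with coefficients -/

section LiftGen

variable {R S : Type*} [CommRing R] [CommRing S] (φ : R →+* S) {f : Fin 5 → S}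

/-- `⟨x₀, …, x₄⟩ ↦ Σ φ(xₖ) fₖ`. [folklore] -/
def liftGenFun (φ : R →+* S) (f : Fin 5 → S) (u : PeriodRing241 R) : S :=
  φ u.c0 * f 0 + φ u.c1 * f 1 + φ u.c2 * f 2 + φ u.c3 * f 3 + φ u.c4 * f 4

set_option maxHeartbeats 4000000 in
/-- **The universal property of `PeriodRing241 R`**: for a ring homomorphism `φ : R → S` and a
period system `f` in `S` (the fifteen period relations of conductor `241` and `Σ fₖ = -1`),
`⟨x₀, …, x₄⟩ ↦ Σ φ(xₖ) fₖ` is a ring homomorphism `PeriodRing241 R →+* S` (verbatim the tree's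
`PeriodRing241.lift`, which is the case `R = ℤ`). [folklore] -/
def liftGen (hf : PeriodRing241.IsPeriodSystem f) : PeriodRing241 R →+* S where
  toFun := liftGenFun φ f
  map_one' := by
    simp only [liftGenFun, PeriodRing241.one_c0, PeriodRing241.one_c1, PeriodRing241.one_c2,
      PeriodRing241.one_c3, PeriodRing241.one_c4, map_neg, map_one]
    linear_combination (-1 : S) * hf.sum_eq
  map_mul' u v := by
    simp only [liftGenFun, PeriodRing241.mul_c0, PeriodRing241.mul_c1, PeriodRing241.mul_c2,
      PeriodRing241.mul_c3, PeriodRing241.mul_c4, map_add, map_sub, map_neg, map_mul, map_ofNat]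
    linear_combination -(((φ u.c0) * (φ v.c0)) * hf.h00 +
      ((φ u.c0) * (φ v.c1) + (φ u.c1) * (φ v.c0)) * hf.h01 +
      ((φ u.c0) * (φ v.c2) + (φ u.c2) * (φ v.c0)) * hf.h02 +
      ((φ u.c0) * (φ v.c3) + (φ u.c3) * (φ v.c0)) * hf.h03 +
      ((φ u.c0) * (φ v.c4) + (φ u.c4) * (φ v.c0)) * hf.h04 +
      ((φ u.c1) * (φ v.c1)) * hf.h11 +
      ((φ u.c1) * (φ v.c2) + (φ u.c2) * (φ v.c1)) * hf.h12 +
      ((φ u.c1) * (φ v.c3) + (φ u.c3) * (φ v.c1)) * hf.h13 +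
      ((φ u.c1) * (φ v.c4) + (φ u.c4) * (φ v.c1)) * hf.h14 +
      ((φ u.c2) * (φ v.c2)) * hf.h22 +
      ((φ u.c2) * (φ v.c3) + (φ u.c3) * (φ v.c2)) * hf.h23 +
      ((φ u.c2) * (φ v.c4) + (φ u.c4) * (φ v.c2)) * hf.h24 +
      ((φ u.c3) * (φ v.c3)) * hf.h33 +
      ((φ u.c3) * (φ v.c4) + (φ u.c4) * (φ v.c3)) * hf.h34 +
      ((φ u.c4) * (φ v.c4)) * hf.h44) -
      48 * ((φ u.c0) * (φ v.c0) + (φ u.c1) * (φ v.c1) + (φ u.c2) * (φ v.c2) + (φ u.c3) * (φ v.c3) +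
        (φ u.c4) * (φ v.c4)) * hf.sum_eq
  map_zero' := by simp [liftGenFun]
  map_add' u v := by
    simp only [liftGenFun, PeriodRing241.add_c0, PeriodRing241.add_c1, PeriodRing241.add_c2,
      PeriodRing241.add_c3, PeriodRing241.add_c4, map_add]
    ring

/-- `liftGen` is `Σ φ(xₖ) fₖ`. [folklore] -/
theorem liftGen_apply (hf : PeriodRing241.IsPeriodSystem f) (u : PeriodRing241 R) :
    liftGen φ hf u = φ u.c0 * f 0 + φ u.c1 * f 1 + φ u.c2 * f 2 + φ u.c3 * f 3 + φ u.c4 * f 4 := rfl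

end LiftGen

/-! ### Two finite tables: `±2^a · 2^i ≡ ±2^{a+i} (mod 11)`, and `ℤ/5` arithmetic -/

/-- If `r ≡ ±2^a (mod 11)` then `r · 2^i ≡ ±2^{i+a} (mod 11)` (exponents in `ℤ/5`, as `2⁵ ≡ -1`).
[folklore] -/
theorem mod11_shift : ∀ r ∈ Finset.range 11, ∀ a i : Fin 5,
    (r = 2 ^ a.val % 11 ∨ (r + 2 ^ a.val) % 11 = 0) →
    ((r * 2 ^ i.val) % 11 = 2 ^ (i + a).val % 11 ∨ (r * 2 ^ i.val + 2 ^ (i + a).val) % 11 = 0) := by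
  decide

/-- Every non-zero residue modulo `11` is `±2^a` (`2` is a primitive root modulo `11`). [folklore] -/
theorem mod11_exists : ∀ r ∈ Finset.range 11, r ≠ 0 →
    ∃ a : Fin 5, r = 2 ^ a.val % 11 ∨ (r + 2 ^ a.val) % 11 = 0 := by
  decide

/-- In `ℤ/5`, `s · b = a` has a non-zero solution `s` for `a, b ≠ 0`. [folklore] -/
theorem fin5_exists_mul_eq : ∀ a b : Fin 5, a ≠ 0 → b ≠ 0 → ∃ s : Fin 5, s ≠ 0 ∧ s * b = a := by
  decide

/-! ### The cosets `C_k` of the fifth powers modulo `241`: multiplication by `C_b` maps `C_k` to `C_{k+b}` -/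

section Cosets

variable {R : Type*} [CommRing R] (ω : R)

/-- The coset `C_k = 7^{5ℤ+k}` of the fifth powers modulo `241`, as a finset of exponents (read off
the tree's indicator list `ind241 k`). [folklore] -/
def Cset (k : Fin 5) : Finset ℕ := (range 241).filter fun a => (ind241 k).getD a 0 = 1

set_option maxRecDepth 100000 in
/-- The indicator lists take the values `0, 1` only. [folklore] -/
theorem ind241_getD_cases : ∀ k : Fin 5, ∀ a ∈ range 241,
    (ind241 k).getD a 0 = 0 ∨ (ind241 k).getD a 0 = 1 := by
  decide +kernel

/-- `f_k = Σ_{a ∈ C_k} ω^a`. [folklore] -/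
theorem evalCyc_ind241_eq_sum_Cset (k : Fin 5) : evalCyc ω (ind241 k) = ∑ a ∈ Cset k, ω ^ a := by
  rw [evalCyc_eq_sum, Cset, Finset.sum_filter, length_ind241]
  refine Finset.sum_congr rfl fun a ha => ?_
  rcases ind241_getD_cases k a ha with h | h
  · rw [if_neg (by rw [h]; norm_num), h, Nat.cast_zero, zero_mul]
  · rw [if_pos h, h, Nat.cast_one, one_mul]

/-- The coset `C_k` as the explicit list of its `48` members (for kernel iteration over members
rather than over all residues). [folklore] -/
def Clist (k : Fin 5) : List ℕ :=
  match k with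
  | 0 => [1,2,4,8,11,15,16,19,22,30,32,38,44,60,63,64,65,76,88,89,111,113,115,120,121,126,128,130,152,153,165,176,177,178,181,197,203,209,211,219,222,225,226,230,233,237,239,240]
  | 1 => [7,14,17,25,27,28,31,34,41,50,54,56,62,67,68,77,82,87,100,105,107,108,112,117,124,129,133,134,136,141,154,159,164,173,174,179,185,187,191,200,207,210,213,214,216,224,227,234]
  | 2 => [3,6,12,13,23,24,26,33,45,46,48,49,52,57,61,66,90,92,96,98,104,109,114,119,122,127,132,137,143,145,149,151,175,180,184,189,192,193,195,196,208,215,217,218,228,229,235,238]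
  | 3 => [5,10,20,21,37,40,42,51,55,59,73,74,75,79,80,81,83,84,91,93,95,102,110,118,123,131,139,146,148,150,157,158,160,161,162,166,167,168,182,186,190,199,201,204,220,221,231,236]
  | 4 => [9,18,29,35,36,39,43,47,53,58,69,70,71,72,78,85,86,94,97,99,101,103,106,116,125,135,138,140,142,144,147,155,156,163,169,170,171,172,183,188,194,198,202,205,206,212,223,232]

set_option maxRecDepth 100000 in
/-- The member lists agree with the indicator lists. [folklore] -/
theorem mem_Clist_iff : ∀ k : Fin 5, ∀ a ∈ range 241, ((ind241 k).getD a 0 = 1 ↔ a ∈ Clist k) := by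
  decide +kernel

set_option maxRecDepth 100000 in
set_option maxHeartbeats 0 in
/-- **`C_b · C_k ⊆ C_{k+b}`** on members (kernel check: `25 · 48 · 48` products). [folklore] -/
theorem Clist_mul_mem : ∀ b k : Fin 5, ∀ n ∈ Clist b, ∀ a ∈ Clist k,
    (ind241 (k + b)).getD (n * a % 241) 0 = 1 := by
  decide +kernel

set_option maxRecDepth 100000 in
/-- Members of `C_b` are residues `< 241`. [folklore] -/
theorem Clist_lt : ∀ b : Fin 5, ∀ n ∈ Clist b, n < 241 := by
  decide +kernel

/-- **`C_b · C_k ⊆ C_{k+b}`**: multiplication by an element of the coset `C_b` maps the coset `C_k`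
into `C_{k+b}`. [folklore] -/
theorem ind241_mul_mem (b : Fin 5) (n : ℕ) (hn : n ∈ range 241) (hb : (ind241 b).getD n 0 = 1)
    (k : Fin 5) (a : ℕ) (ha : a ∈ range 241) (hk : (ind241 k).getD a 0 = 1) :
    (ind241 (k + b)).getD (n * a % 241) 0 = 1 :=
  Clist_mul_mem b k n ((mem_Clist_iff b n hn).mp hb) a ((mem_Clist_iff k a ha).mp hk)

set_option maxRecDepth 100000 in
/-- `|C_k| = 48`. [folklore] -/
theorem card_Cset : ∀ k : Fin 5, (Cset k).card = 48 := by
  decide +kernel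

set_option maxRecDepth 100000 in
/-- Every non-zero residue modulo `241` lies in some coset `C_b`. [folklore] -/
theorem exists_ind241 : ∀ n ∈ range 241, n ≠ 0 → ∃ b : Fin 5, (ind241 b).getD n 0 = 1 := by
  decide +kernel

/-- `0 ∉ C_b`. [folklore] -/
theorem ind241_getD_zero (b : Fin 5) : (ind241 b).getD 0 0 = 0 := by
  fin_cases b <;> rfl

/-- Multiplication by `n` prime to `241` is injective on the residues modulo `241`. [folklore] -/
theorem injOn_mul {n : ℕ} (hn : Nat.Coprime n 241) :
    Set.InjOn (fun a => n * a % 241) (range 241 : Finset ℕ) := by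
  intro a ha b hb hab
  simp only [Finset.coe_range, Set.mem_Iio] at ha hb
  have hmod : a ≡ b [MOD 241] := Nat.ModEq.cancel_left_of_coprime (c := n) hn.symm hab
  rw [Nat.ModEq, Nat.mod_eq_of_lt ha, Nat.mod_eq_of_lt hb] at hmod
  exact hmod

/-- An element of a coset is non-zero and prime to `241`. [folklore] -/
theorem coprime_of_ind241 {b : Fin 5} {n : ℕ} (hn : n ∈ range 241) (hb : (ind241 b).getD n 0 = 1) :
    Nat.Coprime n 241 := by
  have hn0 : n ≠ 0 := by
    rintro rfl
    rw [ind241_getD_zero] at hb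
    exact absurd hb (by norm_num)
  exact (Nat.coprime_of_lt_prime hn0 (mem_range.mp hn) (by norm_num)).symm

/-- **`C_b · C_k = C_{k+b}`** as finsets of residues. [folklore] -/
theorem image_Cset {b : Fin 5} {n : ℕ} (hn : n ∈ range 241) (hb : (ind241 b).getD n 0 = 1) (k : Fin 5) :
    (Cset k).image (fun a => n * a % 241) = Cset (k + b) := by
  have hcop := coprime_of_ind241 hn hb
  have hsub : (Cset k).image (fun a => n * a % 241) ⊆ Cset (k + b) := by
    intro x hx
    rw [Finset.mem_image] at hx
    obtain ⟨a, ha, rfl⟩ := hx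
    rw [Cset, Finset.mem_filter] at ha ⊢
    exact ⟨mem_range.mpr (Nat.mod_lt _ (by norm_num)), ind241_mul_mem b n hn hb k a ha.1 ha.2⟩
  have hinj : Set.InjOn (fun a => n * a % 241) (Cset k) := fun a ha c hc h =>
    injOn_mul hcop (Finset.mem_filter.mp ha).1 (Finset.mem_filter.mp hc).1 h
  refine Finset.eq_of_subset_of_card_le hsub ?_
  rw [Finset.card_image_of_injOn hinj, card_Cset, card_Cset]

/-- `Σ_{a ∈ C_k} ω^{na} = Σ_{a ∈ C_{k+b}} ω^a` for `n ∈ C_b` (`ω²⁴¹ = 1`). [folklore] -/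
theorem sum_Cset_mul (hω : ω ^ 241 = 1) {b : Fin 5} {n : ℕ} (hn : n ∈ range 241)
    (hb : (ind241 b).getD n 0 = 1) (k : Fin 5) :
    ∑ a ∈ Cset k, ω ^ (n * a) = ∑ a ∈ Cset (k + b), ω ^ a := by
  have hmod : ∀ m : ℕ, ω ^ m = ω ^ (m % 241) := fun m => by
    conv_lhs => rw [← Nat.mod_add_div m 241, pow_add, pow_mul, hω, one_pow, mul_one]
  have hcop := coprime_of_ind241 hn hb
  have hinj : Set.InjOn (fun a => n * a % 241) (Cset k) := fun a ha c hc h =>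
    injOn_mul hcop (Finset.mem_filter.mp ha).1 (Finset.mem_filter.mp hc).1 h
  calc ∑ a ∈ Cset k, ω ^ (n * a) = ∑ a ∈ Cset k, ω ^ (n * a % 241) :=
        Finset.sum_congr rfl fun a _ => hmod _
    _ = ∑ x ∈ (Cset k).image (fun a => n * a % 241), ω ^ x := (Finset.sum_image hinj).symm
    _ = ∑ a ∈ Cset (k + b), ω ^ a := by rw [image_Cset hn hb]

/-- **`ω ↦ ω^n` maps `f_k` to `f_{k+b}` for `n ∈ C_b`** (`ω²⁴¹ = 1`): the action of
`Gal(ℚ(ζ₂₄₁)/ℚ)` on the Gaussian periods. [folklore] -/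
theorem evalCyc_pow_ind241 (hω : ω ^ 241 = 1) {b : Fin 5} {n : ℕ} (hn : n ∈ range 241)
    (hb : (ind241 b).getD n 0 = 1) (k : Fin 5) :
    evalCyc (ω ^ n) (ind241 k) = evalCyc ω (ind241 (k + b)) := by
  rw [evalCyc_ind241_eq_sum_Cset, evalCyc_ind241_eq_sum_Cset]
  simp_rw [← pow_mul]
  exact sum_Cset_mul ω hω hn hb k

/-- A fifth power `c⁵`, `c` prime to `241`, lies in `C₀` (tree: `ind241_0_invariant`). [folklore] -/
theorem ind241_zero_pow_five {c : ℕ} (hc : Nat.Coprime c 241) : (ind241 0).getD (c ^ 5 % 241) 0 = 1 := by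
  set c' := c % 241 with hc'
  have hc'lt : c' ∈ range 241 := Finset.mem_range.mpr (Nat.mod_lt _ (by norm_num))
  have hc'0 : c' ≠ 0 := by
    intro h0
    have hdvd : 241 ∣ c := Nat.dvd_of_mod_eq_zero h0
    have := Nat.Coprime.coprime_dvd_left hdvd hc
    norm_num at this
  have h := ind241_0_invariant c' hc'lt hc'0 1 (by decide) (by decide)
  rw [mul_one] at h
  have e : c ^ 5 % 241 = c' ^ 5 % 241 := by rw [hc', ← Nat.pow_mod]
  rw [e]
  exact h

end Cosets

/-! ### The conjugates of `θ11` and the evaluation `R₁₁ → K` -/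

variable (K : Type) [Field K] [NumberField K] [IsCyclotomicExtension {2651} ℚ K]

/-- `c(m) = ζ₁₁^m + ζ₁₁^{-m}`. [folklore] -/
def c11 (m : ℕ) : K := ζ11 K ^ m + (ζ11 K ^ m)⁻¹

/-- `c(1) = θ11`. [folklore] -/
theorem c11_one : c11 K 1 = θ11 K := by
  rw [c11, pow_one, θ11]

/-- `c(m)` only depends on `m mod 11`. [folklore] -/
theorem c11_mod (m : ℕ) : c11 K m = c11 K (m % 11) := by
  have h : ζ11 K ^ m = ζ11 K ^ (m % 11) := by
    conv_lhs => rw [← Nat.mod_add_div m 11, pow_add, pow_mul, ζ11_pow_eleven, one_pow, mul_one]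
  rw [c11, c11, h]

/-- `c(m) = c(m')` if `m + m' ≡ 0 (mod 11)` (`c(-m) = c(m)`). [folklore] -/
theorem c11_eq_of_add_mod {m m' : ℕ} (h : (m + m') % 11 = 0) : c11 K m = c11 K m' := by
  have hmul : ζ11 K ^ m * ζ11 K ^ m' = 1 := by
    rw [← pow_add, ← Nat.mod_add_div (m + m') 11, h, zero_add, pow_mul, ζ11_pow_eleven, one_pow]
  have h1 : (ζ11 K ^ m)⁻¹ = ζ11 K ^ m' := inv_eq_of_mul_eq_one_right hmul
  have h2 : (ζ11 K ^ m')⁻¹ = ζ11 K ^ m := inv_eq_of_mul_eq_one_left hmul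
  rw [c11, c11, h1, h2, add_comm]

/-- `c(m)² - 2 = c(2m)`. [folklore] -/
theorem c11_sq (m : ℕ) : c11 K m ^ 2 - 2 = c11 K (2 * m) := by
  have hz : ζ11 K ^ m ≠ 0 := pow_ne_zero _ (ζ11_ne_zero K)
  rw [c11, c11, mul_comm 2 m, pow_mul]
  field_simp
  ring

/-- **The conjugates `e_i = ζ₁₁^{2ⁱ} + ζ₁₁^{-2ⁱ}` of `θ11 = e₀`** (`i ∈ ℤ/5`; `σ₁₁ⁱ(θ11)` for the
generator `σ₁₁ : ζ₁₁ ↦ ζ₁₁²` of `Gal(ℚ(ζ₁₁)⁺/ℚ)`, the `e'ᵢ` of the tree's `CyclicQuinticField2651Kj`).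
[folklore] -/
def e11 (i : Fin 5) : K := c11 K (2 ^ i.val)

/-- `e₀ = θ11`. [folklore] -/
theorem e11_zero : e11 K 0 = θ11 K := by
  rw [e11, show (0 : Fin 5).val = 0 from rfl, pow_zero, c11_one]

/-- **`e_{i+1} = e_i² - 2`** (for `i = 4`: `2⁵ = 32 ≡ -1 (mod 11)` and `c(-1) = c(1)`). [folklore] -/
theorem e11_succ (i : Fin 5) : e11 K (i + 1) = e11 K i ^ 2 - 2 := by
  fin_cases i
  · show c11 K (2 ^ 1) = c11 K (2 ^ 0) ^ 2 - 2
    rw [c11_sq]; norm_num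
  · show c11 K (2 ^ 2) = c11 K (2 ^ 1) ^ 2 - 2
    rw [c11_sq]; norm_num
  · show c11 K (2 ^ 3) = c11 K (2 ^ 2) ^ 2 - 2
    rw [c11_sq]; norm_num
  · show c11 K (2 ^ 4) = c11 K (2 ^ 3) ^ 2 - 2
    rw [c11_sq]; norm_num
  · show c11 K (2 ^ 0) = c11 K (2 ^ 4) ^ 2 - 2
    rw [c11_sq, c11_mod K (2 * 2 ^ 4)]
    exact c11_eq_of_add_mod K (by norm_num)

/-- `θ11` is a root of the defining polynomial of `R₁₁` (in `eval₂` form). [folklore] -/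
theorem eval₂_poly11_θ11 :
    (QuinticRing.poly (-1 : ℤ) (-3) 3 4 (-1)).eval₂ (Int.castRingHom K) (θ11 K) = 0 := by
  simp only [QuinticRing.poly, eval₂_sub, eval₂_mul, eval₂_C, eval₂_X_pow, eval₂_X, Int.coe_castRingHom,
    Int.cast_neg, Int.cast_ofNat, Int.cast_one]
  linear_combination θ11_rel K

/-- **The evaluation `φ : R₁₁ = ℤ[t]/(f₁₁) → K`, `t ↦ θ11`.** [folklore] -/
def φ11 : R11 →+* K :=
  (AdjoinRoot.lift (Int.castRingHom K) (θ11 K) (eval₂_poly11_θ11 K)).comp QuinticRing.toAdjHom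

/-- `φ(t) = θ11`. [folklore] -/
theorem φ11_gen : φ11 K (QuinticRing.gen ℤ (-1) (-3) 3 4 (-1)) = θ11 K := by
  rw [φ11, RingHom.comp_apply, QuinticRing.toAdjHom_apply, QuinticRing.toAdj_gen, AdjoinRoot.lift_root]

/-- **`φ(e_i) = e_i`**: the explicit quintuples `eR i` evaluate to the conjugates of `θ11`. [folklore] -/
theorem φ11_eR (i : Fin 5) : φ11 K (eR i) = e11 K i := by
  have step : ∀ i : Fin 5, φ11 K (eR i) = e11 K i → φ11 K (eR (i + 1)) = e11 K (i + 1) := by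
    intro i hi
    rw [eR_succ, map_sub, map_mul, map_ofNat, hi, e11_succ, sq]
  have h0 : φ11 K (eR 0) = e11 K 0 := by rw [eR_zero, φ11_gen, e11_zero]
  have h1 := step 0 h0
  have h2 := step 1 h1
  have h3 := step 2 h2
  have h4 := step 3 h3
  fin_cases i
  · exact h0
  · exact h1
  · exact h2
  · exact h3
  · exact h4

/-! ### The Gaussian periods `f_k` of `241` in `K`, the evaluation `T → K`, the elements `P_s` -/

/-- **The five Gaussian periods `f_k = Σ_{c ∈ C_k} ζ₂₄₁^c`** of `241` in `K` (`ζ₂₄₁ = ζ¹¹`,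
`C_k = 7^{5ℤ + k}`; `f₀ = θ241`). [folklore] -/
def fper (k : Fin 5) : K := evalCyc (ω241 K) (ind241 k)

/-- `f₀ = θ241`. [folklore] -/
theorem fper_zero : fper K 0 = θ241 K := rfl

/-- The `f_k` form a period system of conductor `241` (tree: `isPeriodSystem_gauss`). [folklore] -/
theorem isPeriodSystem_fper : PeriodRing241.IsPeriodSystem (fper K) :=
  isPeriodSystem_gauss (ω241 K) (ω241_pow K) (geom_sum_ω241 K)

/-- **The evaluation `Φ : T → K`, `Σ x_k η_k ↦ Σ φ(x_k) f_k`** (a ring homomorphism onto the order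
of `F₅` generated by the `e_i f_k`). [folklore] -/
def Φ25 : T25 →+* K := liftGen (φ11 K) (isPeriodSystem_fper K)

/-- **`P_s = Σ_k e_{sk} f_k ∈ K`** (`s ∈ ℤ/5`): for `s ≠ 0` a generator of one of the four cyclic
quintic subfields of conductor `2651` of `F₅` (`P_{j⁻¹} = Σᵢ e_i f_{ji}` is the orbit sum `g₀` of the
tree's `CyclicQuinticField2651Kj`). [folklore] -/
def Pel (s : Fin 5) : K := ∑ k : Fin 5, e11 K (s * k) * fper K k

/-- `Φ(P_s) = P_s`. [folklore] -/
theorem Φ25_PT (s : Fin 5) : Φ25 K (PT s) = Pel K s := by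
  rw [Φ25, liftGen_apply, Pel, Fin.sum_univ_five]
  simp only [PT, φ11_eR]

/-- **`P₁` is a root of `f₁`** (the polynomial of `CyclicQuinticField2651K1`) in `K`. [folklore] -/
theorem Pel_one_rel :
    Pel K 1 ^ 5 - Pel K 1 ^ 4 - 1060 * Pel K 1 ^ 3 + 8165 * Pel K 1 ^ 2 + 42925 * Pel K 1 - 351649 = 0 := by
  have h := congrArg (Φ25 K) PT_one_rel
  rw [map_zero] at h
  simpa only [map_sub, map_add, map_mul, map_pow, map_ofNat, Φ25_PT] using h

/-- **`P₃` is a root of `f₂`** (the polynomial of `CyclicQuinticField2651K2`) in `K`. [folklore] -/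
theorem Pel_three_rel :
    Pel K 3 ^ 5 - Pel K 3 ^ 4 - 1060 * Pel K 3 ^ 3 - 18345 * Pel K 3 ^ 2 - 105531 * Pel K 3 - 192589 = 0 := by
  have h := congrArg (Φ25 K) PT_three_rel
  rw [map_zero] at h
  simpa only [map_sub, map_add, map_mul, map_pow, map_ofNat, Φ25_PT] using h

/-- **`P₂` is a root of `f₃`** (the polynomial of `CyclicQuinticField2651K3`) in `K`. [folklore] -/
theorem Pel_two_rel :
    Pel K 2 ^ 5 - Pel K 2 ^ 4 - 1060 * Pel K 2 ^ 3 - 7741 * Pel K 2 ^ 2 + 106549 * Pel K 2 + 125531 = 0 := by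
  have h := congrArg (Φ25 K) PT_two_rel
  rw [map_zero] at h
  simpa only [map_sub, map_add, map_mul, map_pow, map_ofNat, Φ25_PT] using h

/-- **`P₄` is a root of `f₄`** (the polynomial of `CyclicQuinticField2651K4`) in `K`. [folklore] -/
theorem Pel_four_rel :
    Pel K 4 ^ 5 - Pel K 4 ^ 4 - 1060 * Pel K 4 ^ 3 + 18769 * Pel K 4 ^ 2 - 105531 * Pel K 4 + 178551 = 0 := by
  have h := congrArg (Φ25 K) PT_four_rel
  rw [map_zero] at h
  simpa only [map_sub, map_add, map_mul, map_pow, map_ofNat, Φ25_PT] using h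

/-! ### The action of `Gal(K/ℚ)` on the `e_i`, the `f_k` and the `P_s` -/

/-- `g(c(m)) = c(Nm)` if `g ζ₁₁ = ζ₁₁^N`. [folklore] -/
theorem gal_c11 (g : K ≃ₐ[ℚ] K) {N : ℕ} (hg : g (ζ11 K) = ζ11 K ^ N) (m : ℕ) :
    g (c11 K m) = c11 K (N * m) := by
  rw [c11, c11, map_add, map_inv₀, map_pow, hg, ← pow_mul]

/-- **`g(e_i) = e_{i+a}` if `g ζ₁₁ = ζ₁₁^N` with `N ≡ ±2^a (mod 11)`.** [folklore] -/
theorem gal_e11 (g : K ≃ₐ[ℚ] K) {N : ℕ} (hg : g (ζ11 K) = ζ11 K ^ N) {a : Fin 5}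
    (ha : N % 11 = 2 ^ a.val % 11 ∨ (N % 11 + 2 ^ a.val) % 11 = 0) (i : Fin 5) :
    g (e11 K i) = e11 K (i + a) := by
  rw [e11, e11, gal_c11 K g hg]
  have hr : N % 11 ∈ Finset.range 11 := Finset.mem_range.mpr (Nat.mod_lt _ (by norm_num))
  have key := mod11_shift (N % 11) hr a i ha
  have hmod : (N * 2 ^ i.val) % 11 = (N % 11 * 2 ^ i.val) % 11 := by
    conv_rhs => rw [Nat.mul_mod, Nat.mod_mod]
    exact Nat.mul_mod _ _ _
  rcases key with h | h
  · rw [c11_mod K (N * 2 ^ i.val), hmod, h, ← c11_mod]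
  · rw [c11_mod K (N * 2 ^ i.val), hmod]
    apply c11_eq_of_add_mod
    rw [Nat.mod_add_mod]
    exact h

/-- The exponent of an element of the subgroup of fifth powers: `g ζ₁₁ = ζ₁₁^{c⁵}`, `g ζ₂₄₁ = ζ₂₄₁^{c⁵}`
for some `c` prime to `2651`. [folklore] -/
theorem exists_pow_five_of_mem_galFifthPowers {g : K ≃ₐ[ℚ] K} (hg : g ∈ galFifthPowers K) :
    ∃ c : ℕ, Nat.Coprime c 2651 ∧ g (ζ11 K) = ζ11 K ^ c ^ 5 ∧ g (ω241 K) = ω241 K ^ c ^ 5 := by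
  rw [galFifthPowers, Subgroup.mem_comap, MonoidHom.mem_range] at hg
  obtain ⟨b, hb⟩ := hg
  rw [powMonoidHom_apply] at hb
  set c : ℕ := ((b : (ZMod 2651)ˣ) : ZMod 2651).val with hc
  have hval : ((IsCyclotomicExtension.Rat.galEquivZMod 2651 K) g).val.val = c ^ 5 % 2651 := by
    have e : ((IsCyclotomicExtension.Rat.galEquivZMod 2651 K) g : (ZMod 2651)ˣ) = b ^ 5 := by
      rw [hb]; rfl
    rw [e, Units.val_pow_eq_pow_val, ← ZMod.natCast_zmod_val ((b : (ZMod 2651)ˣ) : ZMod 2651),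
      ← hc, ← Nat.cast_pow, ZMod.val_natCast]
  refine ⟨c, ZMod.val_coe_unit_coprime b, ?_, ?_⟩
  · have hw : ζ11 K ^ 2651 = 1 := by
      rw [show 2651 = 11 * 241 by norm_num, pow_mul, ζ11_pow_eleven, one_pow]
    have hmod : ∀ m : ℕ, ζ11 K ^ m = ζ11 K ^ (m % 2651) := fun m => by
      conv_lhs => rw [← Nat.mod_add_div m 2651, pow_add, pow_mul, hw, one_pow, mul_one]
    rw [IsCyclotomicExtension.Rat.galEquivZMod_apply_of_pow_eq 2651 K g hw, hval, ← hmod]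
  · have hw : ω241 K ^ 2651 = 1 := by
      rw [show 2651 = 241 * 11 by norm_num, pow_mul, ω241_pow, one_pow]
    have hmod : ∀ m : ℕ, ω241 K ^ m = ω241 K ^ (m % 2651) := fun m => by
      conv_lhs => rw [← Nat.mod_add_div m 2651, pow_add, pow_mul, hw, one_pow, mul_one]
    rw [IsCyclotomicExtension.Rat.galEquivZMod_apply_of_pow_eq 2651 K g hw, hval, ← hmod]

/-- **`c(m) ∈ F₅`**: a fifth power acts on `ζ₁₁` by `ζ₁₁ ↦ ζ₁₁^{±1}` (tree: `ζ11_pow_pow_five`). [folklore] -/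
theorem c11_mem_F5 (m : ℕ) : c11 K m ∈ F5 K := by
  rw [F5, IntermediateField.mem_fixedField_iff]
  intro g hg
  obtain ⟨c, hc, hgz, -⟩ := exists_pow_five_of_mem_galFifthPowers K hg
  have hcop : Nat.Coprime c 11 := hc.coprime_dvd_right (by norm_num)
  change g (c11 K m) = c11 K m
  rcases ζ11_pow_pow_five K hcop with h | h
  · rw [c11, map_add, map_inv₀, map_pow, hgz, h]
  · rw [c11, map_add, map_inv₀, map_pow, hgz, h, inv_pow, inv_inv, add_comm]

/-- `e_i ∈ F₅`. [folklore] -/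
theorem e11_mem_F5 (i : Fin 5) : e11 K i ∈ F5 K := c11_mem_F5 K _

/-- **`g(f_k) = f_{k+b}` if `g ζ₂₄₁ = ζ₂₄₁^N` with `N mod 241 ∈ C_b`.** [folklore] -/
theorem gal_fper (g : K ≃ₐ[ℚ] K) {N : ℕ} (hg : g (ω241 K) = ω241 K ^ N) {b : Fin 5}
    (hb : (ind241 b).getD (N % 241) 0 = 1) (k : Fin 5) : g (fper K k) = fper K (k + b) := by
  have hmod : ω241 K ^ N = ω241 K ^ (N % 241) := by
    conv_lhs => rw [← Nat.mod_add_div N 241, pow_add, pow_mul, ω241_pow, one_pow, mul_one]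
  rw [fper, fper, map_evalCyc, hg, hmod]
  exact evalCyc_pow_ind241 (ω241 K) (ω241_pow K) (mem_range.mpr (Nat.mod_lt _ (by norm_num))) hb k

/-- **`f_k ∈ F₅`**: a fifth power `c⁵` lies in `C₀`, so it fixes every `f_k`. [folklore] -/
theorem fper_mem_F5 (k : Fin 5) : fper K k ∈ F5 K := by
  rw [F5, IntermediateField.mem_fixedField_iff]
  intro g hg
  obtain ⟨c, hc, -, hgw⟩ := exists_pow_five_of_mem_galFifthPowers K hg
  have hcop : Nat.Coprime c 241 := hc.coprime_dvd_right (by norm_num)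
  change g (fper K k) = fper K k
  have h := gal_fper K g hgw (b := 0) (ind241_zero_pow_five hcop) k
  rwa [add_zero] at h

/-- **`P_s ∈ F₅`.** [folklore] -/
theorem Pel_mem_F5 (s : Fin 5) : Pel K s ∈ F5 K :=
  IntermediateField.sum_mem _ fun k _ => IntermediateField.mul_mem _ (e11_mem_F5 K _) (fper_mem_F5 K k)

/-- **`P_s` as an element of `F₅`.** [folklore] -/
def PelF (s : Fin 5) : F5 K := ⟨Pel K s, Pel_mem_F5 K s⟩

/-- `P₁F` is a root of `f₁` (in `F₅`). [folklore] -/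
theorem PelF_one_rel : PelF K 1 ^ 5 - PelF K 1 ^ 4 - 1060 * PelF K 1 ^ 3 + 8165 * PelF K 1 ^ 2 +
    42925 * PelF K 1 - 351649 = 0 := by
  apply (algebraMap (F5 K) K).injective
  simp only [map_add, map_sub, map_mul, map_pow, map_ofNat, map_zero]
  exact Pel_one_rel K

/-- `P₃F` is a root of `f₂` (in `F₅`). [folklore] -/
theorem PelF_three_rel : PelF K 3 ^ 5 - PelF K 3 ^ 4 - 1060 * PelF K 3 ^ 3 - 18345 * PelF K 3 ^ 2 -
    105531 * PelF K 3 - 192589 = 0 := by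
  apply (algebraMap (F5 K) K).injective
  simp only [map_sub, map_mul, map_pow, map_ofNat, map_zero]
  exact Pel_three_rel K

/-- `P₂F` is a root of `f₃` (in `F₅`). [folklore] -/
theorem PelF_two_rel : PelF K 2 ^ 5 - PelF K 2 ^ 4 - 1060 * PelF K 2 ^ 3 - 7741 * PelF K 2 ^ 2 +
    106549 * PelF K 2 + 125531 = 0 := by
  apply (algebraMap (F5 K) K).injective
  simp only [map_add, map_sub, map_mul, map_pow, map_ofNat, map_zero]
  exact Pel_two_rel K

/-- `P₄F` is a root of `f₄` (in `F₅`). [folklore] -/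
theorem PelF_four_rel : PelF K 4 ^ 5 - PelF K 4 ^ 4 - 1060 * PelF K 4 ^ 3 + 18769 * PelF K 4 ^ 2 -
    105531 * PelF K 4 + 178551 = 0 := by
  apply (algebraMap (F5 K) K).injective
  simp only [map_add, map_sub, map_mul, map_pow, map_ofNat, map_zero]
  exact Pel_four_rel K

/-- **`g(P_s) = P_s` when `g ζ₁₁ = ζ₁₁^N`, `g ζ₂₄₁ = ζ₂₄₁^N`, `N ≡ ±2^a (mod 11)`, `N mod 241 ∈ C_b`
and `s b = a`**: `g` shifts `e_i ↦ e_{i+a}`, `f_k ↦ f_{k+b}`, and `Σ_k e_{s(k+b)} f_{k+b} = Σ_k e_{sk} f_k`.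
[folklore] -/
theorem gal_Pel (g : K ≃ₐ[ℚ] K) {N : ℕ} (hg11 : g (ζ11 K) = ζ11 K ^ N) (hg241 : g (ω241 K) = ω241 K ^ N)
    {a b s : Fin 5} (ha : N % 11 = 2 ^ a.val % 11 ∨ (N % 11 + 2 ^ a.val) % 11 = 0)
    (hb : (ind241 b).getD (N % 241) 0 = 1) (hs : s * b = a) : g (Pel K s) = Pel K s := by
  rw [Pel, map_sum]
  simp_rw [map_mul, gal_e11 K g hg11 ha, gal_fper K g hg241 hb]
  have e : ∀ k : Fin 5, e11 K (s * k + a) * fper K (k + b) =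
      (fun m => e11 K (s * m) * fper K m) (Equiv.addRight b k) := by
    intro k
    simp only [Equiv.coe_addRight, mul_add, hs]
  simp_rw [e]
  exact Fintype.sum_equiv (Equiv.addRight b) _ _ (fun k => rfl)

/-- The exponent of an element of `Gal(K/ℚ)`: `g ζ₁₁ = ζ₁₁^N`, `g ζ₂₄₁ = ζ₂₄₁^N`, `N` prime to `2651`.
[folklore] -/
theorem exists_exponent (g : K ≃ₐ[ℚ] K) :
    ∃ N : ℕ, Nat.Coprime N 2651 ∧ g (ζ11 K) = ζ11 K ^ N ∧ g (ω241 K) = ω241 K ^ N := by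
  refine ⟨((IsCyclotomicExtension.Rat.galEquivZMod 2651 K) g).val.val,
    ZMod.val_coe_unit_coprime _, ?_, ?_⟩
  · have hw : ζ11 K ^ 2651 = 1 := by
      rw [show 2651 = 11 * 241 by norm_num, pow_mul, ζ11_pow_eleven, one_pow]
    exact IsCyclotomicExtension.Rat.galEquivZMod_apply_of_pow_eq 2651 K g hw
  · have hw : ω241 K ^ 2651 = 1 := by
      rw [show 2651 = 241 * 11 by norm_num, pow_mul, ω241_pow, one_pow]
    exact IsCyclotomicExtension.Rat.galEquivZMod_apply_of_pow_eq 2651 K g hw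

set_option backward.isDefEq.respectTransparency false in
/-- Every `σ ∈ Gal(F₅/ℚ)` is the restriction of some `g ∈ Gal(K/ℚ)` (`F₅/ℚ` is normal). [folklore] -/
theorem F5.exists_lift (σ : Gal((F5 K)/ℚ)) : ∃ g : K ≃ₐ[ℚ] K, ∀ x : F5 K, (σ x : K) = g x := by
  haveI := IsCyclotomicExtension.isGalois {2651} ℚ K
  haveI := isGalois_F5 K
  obtain ⟨g, hg⟩ := AlgEquiv.restrictNormalHom_surjective (F := ℚ) (K₁ := F5 K) (E := K) σ
  refine ⟨g, fun x => ?_⟩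
  rw [← hg]
  exact AlgEquiv.restrictNormalHom_apply (F5 K) g x

set_option backward.isDefEq.respectTransparency false in
/-- **The four conductor-`2651` quintic subfields located.** If `σ ∈ Gal(F₅/ℚ)` moves both `θ11`
and `θ241`, then `σ` fixes `P_s` for some `s ≠ 0`: lifting `σ` to `g ∈ Gal(K/ℚ)` with exponent `N`,
`N ≡ ±2^a (mod 11)` with `a ≠ 0` (else `g` fixes `θ11 = c(1)`), `N mod 241 ∈ C_b` with `b ≠ 0` (else
`g` fixes `θ241 = f₀`), and `s = a b⁻¹`. [folklore] -/
theorem F5.exists_PelF_fixed {σ : Gal((F5 K)/ℚ)} (h11 : σ (θ11F K) ≠ θ11F K)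
    (h241 : σ (θ241F K) ≠ θ241F K) : ∃ s : Fin 5, s ≠ 0 ∧ σ (PelF K s) = PelF K s := by
  obtain ⟨g, hg⟩ := F5.exists_lift K σ
  obtain ⟨N, hN, hg11, hg241⟩ := exists_exponent K g
  have hN11 : N % 11 ≠ 0 := by
    intro h
    have := Nat.Coprime.coprime_dvd_left (Nat.dvd_of_mod_eq_zero h) hN
    norm_num at this
  have hN241 : N % 241 ≠ 0 := by
    intro h
    have := Nat.Coprime.coprime_dvd_left (Nat.dvd_of_mod_eq_zero h) hN
    norm_num at this
  obtain ⟨a, ha⟩ := mod11_exists (N % 11) (mem_range.mpr (Nat.mod_lt _ (by norm_num))) hN11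
  obtain ⟨b, hb⟩ := exists_ind241 (N % 241) (mem_range.mpr (Nat.mod_lt _ (by norm_num))) hN241
  have ha0 : a ≠ 0 := by
    rintro rfl
    apply h11
    apply Subtype.ext
    rw [hg]
    change g (θ11 K) = θ11 K
    rw [← c11_one, gal_c11 K g hg11, mul_one, c11_mod K N]
    rcases ha with h | h
    · have h' : N % 11 = 1 := by simpa using h
      rw [h']
    · exact c11_eq_of_add_mod K (by simpa using h)
  have hb0 : b ≠ 0 := by
    rintro rfl
    apply h241
    apply Subtype.ext
    rw [hg]
    change g (θ241 K) = θ241 K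
    rw [← fper_zero, gal_fper K g hg241 hb 0, add_zero]
  obtain ⟨s, hs0, hs⟩ := fin5_exists_mul_eq a b ha0 hb0
  refine ⟨s, hs0, Subtype.ext ?_⟩
  rw [hg]
  exact gal_Pel K g hg11 hg241 ha hb hs

/-! ### Transport of the quintic descents along `ℚ[X]/(f_j) ≃ F₅^{⟨σ⟩}` -/

section Transport

variable {A L : Type*} [Field A] [Algebra ℚ A] [Field L] [Algebra ℚ L]

/-- **Transport of a norm-`1` descent statement along `A ≃ₐ[ℚ] L`** (verbatim the tree's
`CyclicQuintic241.normDescent_of_algEquiv`, with the descent over `A` as a hypothesis). [folklore] -/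
theorem normDescent_transport (g : A ≃ₐ[ℚ] L)
    (h : ∀ {x y : A}, y ^ 2 = x * (x + 2) * (x - 3) → y ≠ 0 → IsSquare (Algebra.norm ℚ x) →
      IsSquare (Algebra.norm ℚ (x + 2)) → IsSquare x ∧ IsSquare (x + 2))
    {x y : L} (hE : y ^ 2 = x * (x + 2) * (x - 3)) (hy : y ≠ 0) (hNx : IsSquare (Algebra.norm ℚ x))
    (hNx2 : IsSquare (Algebra.norm ℚ (x + 2))) : IsSquare x ∧ IsSquare (x + 2) := by
  set x₀ := g.symm x with hx₀
  set y₀ := g.symm y with hy₀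
  have hx : x = g x₀ := (g.apply_symm_apply x).symm
  have hyy : y = g y₀ := (g.apply_symm_apply y).symm
  have hE₀ : y₀ ^ 2 = x₀ * (x₀ + 2) * (x₀ - 3) := by
    apply g.injective
    rw [map_pow, map_mul, map_mul, map_add, map_sub, map_ofNat, map_ofNat, ← hx, ← hyy, hE]
  have hy₀' : y₀ ≠ 0 := fun h0 => hy (by rw [hyy, h0, map_zero])
  have hN₀ : Algebra.norm ℚ x₀ = Algebra.norm ℚ x := by
    rw [hx, Algebra.norm_eq_of_algEquiv g x₀]
  have hN₂ : Algebra.norm ℚ (x₀ + 2) = Algebra.norm ℚ (x + 2) := by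
    rw [← Algebra.norm_eq_of_algEquiv g (x₀ + 2), map_add, map_ofNat, ← hx]
  obtain ⟨h1, h2⟩ := h hE₀ hy₀' (hN₀ ▸ hNx) (hN₂ ▸ hNx2)
  have sq : ∀ {z : A}, IsSquare z → IsSquare (g z) := fun ⟨r, hr⟩ => ⟨g r, by rw [hr, map_mul]⟩
  refine ⟨hx ▸ sq h1, ?_⟩
  have e : x + 2 = g (x₀ + 2) := by rw [map_add, map_ofNat, ← hx]
  rw [e]
  exact sq h2

/-- **`ℚ[X]/(p) ≃ₐ[ℚ] L` from a root of `p` in `L` when the degrees agree** (injective as a field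
homomorphism, hence bijective). [folklore] -/
def algEquivAdjoinRootOfRoot (p : ℚ[X]) [Fact (Irreducible p)] [FiniteDimensional ℚ (AdjoinRoot p)]
    [FiniteDimensional ℚ L] (hdeg : Module.finrank ℚ (AdjoinRoot p) = Module.finrank ℚ L) {θ' : L}
    (h : aeval θ' p = 0) : AdjoinRoot p ≃ₐ[ℚ] L :=
  AlgEquiv.ofBijective (AdjoinRoot.liftAlgHom p (Algebra.ofId ℚ L) θ' h)
    ⟨(AdjoinRoot.liftAlgHom p (Algebra.ofId ℚ L) θ' h).toRingHom.injective,
     (LinearMap.injective_iff_surjective_of_finrank_eq_finrank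
        (f := (AdjoinRoot.liftAlgHom p (Algebra.ofId ℚ L) θ' h).toLinearMap) hdeg).mp
        (AdjoinRoot.liftAlgHom p (Algebra.ofId ℚ L) θ' h).toRingHom.injective⟩

/-- **The descent over a quintic field with a root of `f₁`, from the descent over
`CyclicQuintic2651K1.K = ℚ[X]/(f₁)`.** [folklore] -/
theorem normDescent_of_root_K1 (h5 : Module.finrank ℚ L = 5)
    (h1 : ∀ {x y : CyclicQuintic2651K1.K}, y ^ 2 = x * (x + 2) * (x - 3) → y ≠ 0 →
      IsSquare (Algebra.norm ℚ x) → IsSquare (Algebra.norm ℚ (x + 2)) → IsSquare x ∧ IsSquare (x + 2))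
    {θ' : L} (hθ' : θ' ^ 5 - θ' ^ 4 - 1060 * θ' ^ 3 + 8165 * θ' ^ 2 + 42925 * θ' - 351649 = 0)
    {x y : L} (hE : y ^ 2 = x * (x + 2) * (x - 3)) (hy : y ≠ 0) (hNx : IsSquare (Algebra.norm ℚ x))
    (hNx2 : IsSquare (Algebra.norm ℚ (x + 2))) : IsSquare x ∧ IsSquare (x + 2) := by
  haveI : FiniteDimensional ℚ L := Module.finite_of_finrank_eq_succ h5
  have ha : aeval θ' CyclicQuintic2651K1.quinticPolyRat = 0 := by
    rw [CyclicQuintic2651K1.quinticPolyRat_eq]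
    simp only [map_sub, map_add, map_mul, aeval_X_pow, aeval_X, map_ofNat]
    exact hθ'
  exact normDescent_transport (algEquivAdjoinRootOfRoot CyclicQuintic2651K1.quinticPolyRat
    (by rw [CyclicQuintic2651K1.finrank_K, h5]) ha) h1 hE hy hNx hNx2

/-- **The descent over a quintic field with a root of `f₂`, from the descent over
`CyclicQuintic2651K2.K = ℚ[X]/(f₂)`.** [folklore] -/
theorem normDescent_of_root_K2 (h5 : Module.finrank ℚ L = 5)
    (h2 : ∀ {x y : CyclicQuintic2651K2.K}, y ^ 2 = x * (x + 2) * (x - 3) → y ≠ 0 →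
      IsSquare (Algebra.norm ℚ x) → IsSquare (Algebra.norm ℚ (x + 2)) → IsSquare x ∧ IsSquare (x + 2))
    {θ' : L} (hθ' : θ' ^ 5 - θ' ^ 4 - 1060 * θ' ^ 3 - 18345 * θ' ^ 2 - 105531 * θ' - 192589 = 0)
    {x y : L} (hE : y ^ 2 = x * (x + 2) * (x - 3)) (hy : y ≠ 0) (hNx : IsSquare (Algebra.norm ℚ x))
    (hNx2 : IsSquare (Algebra.norm ℚ (x + 2))) : IsSquare x ∧ IsSquare (x + 2) := by
  haveI : FiniteDimensional ℚ L := Module.finite_of_finrank_eq_succ h5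
  have ha : aeval θ' CyclicQuintic2651K2.quinticPolyRat = 0 := by
    rw [CyclicQuintic2651K2.quinticPolyRat_eq]
    simp only [map_sub, map_mul, aeval_X_pow, aeval_X, map_ofNat]
    exact hθ'
  exact normDescent_transport (algEquivAdjoinRootOfRoot CyclicQuintic2651K2.quinticPolyRat
    (by rw [CyclicQuintic2651K2.finrank_K, h5]) ha) h2 hE hy hNx hNx2

/-- **The descent over a quintic field with a root of `f₃`, from the descent over
`CyclicQuintic2651K3.K = ℚ[X]/(f₃)`.** [folklore] -/
theorem normDescent_of_root_K3 (h5 : Module.finrank ℚ L = 5)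
    (h3 : ∀ {x y : CyclicQuintic2651K3.K}, y ^ 2 = x * (x + 2) * (x - 3) → y ≠ 0 →
      IsSquare (Algebra.norm ℚ x) → IsSquare (Algebra.norm ℚ (x + 2)) → IsSquare x ∧ IsSquare (x + 2))
    {θ' : L} (hθ' : θ' ^ 5 - θ' ^ 4 - 1060 * θ' ^ 3 - 7741 * θ' ^ 2 + 106549 * θ' + 125531 = 0)
    {x y : L} (hE : y ^ 2 = x * (x + 2) * (x - 3)) (hy : y ≠ 0) (hNx : IsSquare (Algebra.norm ℚ x))
    (hNx2 : IsSquare (Algebra.norm ℚ (x + 2))) : IsSquare x ∧ IsSquare (x + 2) := by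
  haveI : FiniteDimensional ℚ L := Module.finite_of_finrank_eq_succ h5
  have ha : aeval θ' CyclicQuintic2651K3.quinticPolyRat = 0 := by
    rw [CyclicQuintic2651K3.quinticPolyRat_eq]
    simp only [map_sub, map_add, map_mul, aeval_X_pow, aeval_X, map_ofNat]
    exact hθ'
  exact normDescent_transport (algEquivAdjoinRootOfRoot CyclicQuintic2651K3.quinticPolyRat
    (by rw [CyclicQuintic2651K3.finrank_K, h5]) ha) h3 hE hy hNx hNx2

/-- **The descent over a quintic field with a root of `f₄`, from the descent over
`CyclicQuintic2651K4.K = ℚ[X]/(f₄)`.** [folklore] -/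
theorem normDescent_of_root_K4 (h5 : Module.finrank ℚ L = 5)
    (h4 : ∀ {x y : CyclicQuintic2651K4.K}, y ^ 2 = x * (x + 2) * (x - 3) → y ≠ 0 →
      IsSquare (Algebra.norm ℚ x) → IsSquare (Algebra.norm ℚ (x + 2)) → IsSquare x ∧ IsSquare (x + 2))
    {θ' : L} (hθ' : θ' ^ 5 - θ' ^ 4 - 1060 * θ' ^ 3 + 18769 * θ' ^ 2 - 105531 * θ' + 178551 = 0)
    {x y : L} (hE : y ^ 2 = x * (x + 2) * (x - 3)) (hy : y ≠ 0) (hNx : IsSquare (Algebra.norm ℚ x))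
    (hNx2 : IsSquare (Algebra.norm ℚ (x + 2))) : IsSquare x ∧ IsSquare (x + 2) := by
  haveI : FiniteDimensional ℚ L := Module.finite_of_finrank_eq_succ h5
  have ha : aeval θ' CyclicQuintic2651K4.quinticPolyRat = 0 := by
    rw [CyclicQuintic2651K4.quinticPolyRat_eq]
    simp only [map_sub, map_add, map_mul, aeval_X_pow, aeval_X, map_ofNat]
    exact hθ'
  exact normDescent_transport (algEquivAdjoinRootOfRoot CyclicQuintic2651K4.quinticPolyRat
    (by rw [CyclicQuintic2651K4.finrank_K, h5]) ha) h4 hE hy hNx hNx2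

end Transport

/-! ### The four conductor-`2651` descents inside `F₅`, from the abstract ones -/

set_option backward.isDefEq.respectTransparency false in
/-- **The norm-`1` `2`-descent of `480a1` over the quintic subfields `F₅^{⟨σ⟩}` with `σ` moving BOTH
`θ11` and `θ241` — the four cyclic quintic fields of conductor `2651` — from the descents over the
abstract fields `CyclicQuintic2651Kj.K = ℚ[X]/(f_j)`, `j = 1, …, 4`.** Such a `σ` fixes some `P_s`,
`s ≠ 0` (`F5.exists_PelF_fixed`), so the quintic field `F₅^{⟨σ⟩}` contains a root of `f_{s⁻¹}` and is a
copy of `ℚ[X]/(f_{s⁻¹})`, along which the descent statement is transported.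
[cite: DokchitserDokchitser2011RankModN, proof of Thm. 2 (2-descent over the minimal non-trivial subfields of F₅)] -/
theorem F5.normDescent_fixedField_of_normDescent_K
    (h1 : ∀ {x y : CyclicQuintic2651K1.K}, y ^ 2 = x * (x + 2) * (x - 3) → y ≠ 0 →
      IsSquare (Algebra.norm ℚ x) → IsSquare (Algebra.norm ℚ (x + 2)) → IsSquare x ∧ IsSquare (x + 2))
    (h2 : ∀ {x y : CyclicQuintic2651K2.K}, y ^ 2 = x * (x + 2) * (x - 3) → y ≠ 0 →
      IsSquare (Algebra.norm ℚ x) → IsSquare (Algebra.norm ℚ (x + 2)) → IsSquare x ∧ IsSquare (x + 2))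
    (h3 : ∀ {x y : CyclicQuintic2651K3.K}, y ^ 2 = x * (x + 2) * (x - 3) → y ≠ 0 →
      IsSquare (Algebra.norm ℚ x) → IsSquare (Algebra.norm ℚ (x + 2)) → IsSquare x ∧ IsSquare (x + 2))
    (h4 : ∀ {x y : CyclicQuintic2651K4.K}, y ^ 2 = x * (x + 2) * (x - 3) → y ≠ 0 →
      IsSquare (Algebra.norm ℚ x) → IsSquare (Algebra.norm ℚ (x + 2)) → IsSquare x ∧ IsSquare (x + 2))
    {σ : Gal((F5 K)/ℚ)} (hσ : σ ≠ 1) (h11 : σ (θ11F K) ≠ θ11F K) (h241 : σ (θ241F K) ≠ θ241F K) :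
    ∀ x y : fixedField (Subgroup.zpowers σ),
      (curve480a1.baseChange (fixedField (Subgroup.zpowers σ))).toAffine.Nonsingular x y →
      x ≠ 0 → x ≠ -2 → x ≠ 3 → IsSquare (Algebra.norm ℚ x) → IsSquare (Algebra.norm ℚ (x + 2)) →
      IsSquare x ∧ IsSquare (x + 2) := by
  intro x y hxy h0 h2' h3' hN hN2
  have hpt := curve480a1.eq_and_ne_of_nonsingular (fixedField (Subgroup.zpowers σ)) hxy h0 h2' h3'
  have h5 := F5.finrank_fixedField_zpowers K hσ
  obtain ⟨s, hs0, hfix⟩ := F5.exists_PelF_fixed K h11 h241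
  have hinj := (algebraMap (fixedField (Subgroup.zpowers σ)) (F5 K)).injective
  fin_cases s
  · exact absurd rfl hs0
  · set θ' : fixedField (Subgroup.zpowers σ) := ⟨PelF K 1, F5.mem_fixedField_zpowers_of_apply_eq K hfix⟩
      with hθ'
    have hrel : θ' ^ 5 - θ' ^ 4 - 1060 * θ' ^ 3 + 8165 * θ' ^ 2 + 42925 * θ' - 351649 = 0 := by
      apply hinj
      simp only [map_add, map_sub, map_mul, map_pow, map_ofNat, map_zero]
      exact PelF_one_rel K
    exact normDescent_of_root_K1 h5 h1 hrel hpt.1 hpt.2 hN hN2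
  · set θ' : fixedField (Subgroup.zpowers σ) := ⟨PelF K 2, F5.mem_fixedField_zpowers_of_apply_eq K hfix⟩
      with hθ'
    have hrel : θ' ^ 5 - θ' ^ 4 - 1060 * θ' ^ 3 - 7741 * θ' ^ 2 + 106549 * θ' + 125531 = 0 := by
      apply hinj
      simp only [map_add, map_sub, map_mul, map_pow, map_ofNat, map_zero]
      exact PelF_two_rel K
    exact normDescent_of_root_K3 h5 h3 hrel hpt.1 hpt.2 hN hN2
  · set θ' : fixedField (Subgroup.zpowers σ) := ⟨PelF K 3, F5.mem_fixedField_zpowers_of_apply_eq K hfix⟩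
      with hθ'
    have hrel : θ' ^ 5 - θ' ^ 4 - 1060 * θ' ^ 3 - 18345 * θ' ^ 2 - 105531 * θ' - 192589 = 0 := by
      apply hinj
      simp only [map_sub, map_mul, map_pow, map_ofNat, map_zero]
      exact PelF_three_rel K
    exact normDescent_of_root_K2 h5 h2 hrel hpt.1 hpt.2 hN hN2
  · set θ' : fixedField (Subgroup.zpowers σ) := ⟨PelF K 4, F5.mem_fixedField_zpowers_of_apply_eq K hfix⟩
      with hθ'
    have hrel : θ' ^ 5 - θ' ^ 4 - 1060 * θ' ^ 3 + 18769 * θ' ^ 2 - 105531 * θ' + 178551 = 0 := by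
      apply hinj
      simp only [map_add, map_sub, map_mul, map_pow, map_ofNat, map_zero]
      exact PelF_four_rel K
    exact normDescent_of_root_K4 h5 h4 hrel hpt.1 hpt.2 hN hN2

end DokchitserDokchitser2011

open DokchitserDokchitser2011 Literature.NumberTheory.NumberFields

set_option backward.isDefEq.respectTransparency false in
/-- **The child named fact `DokchitserDokchitser2011_normDescent_480a1_quintic2651` (the four
conductor-`2651` quintic descents inside `F₅ = F5 (CyclotomicField 2651 ℚ)`) follows from the
norm-`1` `2`-descents of `480a1` over the four abstract cyclic quintic fields
`CyclicQuintic2651Kj.K = ℚ[X]/(f_j)` of the tree** (`NumberFields/CyclicQuinticField2651Kj.lean`).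
[cite: DokchitserDokchitser2011RankModN, proof of Thm. 2 (2-descent over the minimal non-trivial subfields of F₅)] -/
theorem DokchitserDokchitser2011_normDescent_480a1_quintic2651_of_normDescent_K
    (h1 : ∀ {x y : CyclicQuintic2651K1.K}, y ^ 2 = x * (x + 2) * (x - 3) → y ≠ 0 →
      IsSquare (Algebra.norm ℚ x) → IsSquare (Algebra.norm ℚ (x + 2)) → IsSquare x ∧ IsSquare (x + 2))
    (h2 : ∀ {x y : CyclicQuintic2651K2.K}, y ^ 2 = x * (x + 2) * (x - 3) → y ≠ 0 →
      IsSquare (Algebra.norm ℚ x) → IsSquare (Algebra.norm ℚ (x + 2)) → IsSquare x ∧ IsSquare (x + 2))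
    (h3 : ∀ {x y : CyclicQuintic2651K3.K}, y ^ 2 = x * (x + 2) * (x - 3) → y ≠ 0 →
      IsSquare (Algebra.norm ℚ x) → IsSquare (Algebra.norm ℚ (x + 2)) → IsSquare x ∧ IsSquare (x + 2))
    (h4 : ∀ {x y : CyclicQuintic2651K4.K}, y ^ 2 = x * (x + 2) * (x - 3) → y ≠ 0 →
      IsSquare (Algebra.norm ℚ x) → IsSquare (Algebra.norm ℚ (x + 2)) → IsSquare x ∧ IsSquare (x + 2)) :
    DokchitserDokchitser2011_normDescent_480a1_quintic2651 :=
  fun _ hσ h11 h241 => F5.normDescent_fixedField_of_normDescent_K (CyclotomicField 2651 ℚ) h1 h2 h3 h4 hσ h11 h241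

set_option backward.isDefEq.respectTransparency false in
/-- **Hence the capped named fact `DokchitserDokchitser2011_rank_480a1_F5` (the `n = 5` witness of
Theorem 2: `F₅`, its splitting, `rk E(F₅) = 1`) follows from the four abstract quintic descents**
(tree: `DokchitserDokchitser2011_rank_480a1_F5_holds_of`).
[cite: DokchitserDokchitser2011RankModN, proof of Thm. 2] -/
theorem DokchitserDokchitser2011_rank_480a1_F5_of_normDescent_K
    (h1 : ∀ {x y : CyclicQuintic2651K1.K}, y ^ 2 = x * (x + 2) * (x - 3) → y ≠ 0 →
      IsSquare (Algebra.norm ℚ x) → IsSquare (Algebra.norm ℚ (x + 2)) → IsSquare x ∧ IsSquare (x + 2))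
    (h2 : ∀ {x y : CyclicQuintic2651K2.K}, y ^ 2 = x * (x + 2) * (x - 3) → y ≠ 0 →
      IsSquare (Algebra.norm ℚ x) → IsSquare (Algebra.norm ℚ (x + 2)) → IsSquare x ∧ IsSquare (x + 2))
    (h3 : ∀ {x y : CyclicQuintic2651K3.K}, y ^ 2 = x * (x + 2) * (x - 3) → y ≠ 0 →
      IsSquare (Algebra.norm ℚ x) → IsSquare (Algebra.norm ℚ (x + 2)) → IsSquare x ∧ IsSquare (x + 2))
    (h4 : ∀ {x y : CyclicQuintic2651K4.K}, y ^ 2 = x * (x + 2) * (x - 3) → y ≠ 0 →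
      IsSquare (Algebra.norm ℚ x) → IsSquare (Algebra.norm ℚ (x + 2)) → IsSquare x ∧ IsSquare (x + 2)) :
    DokchitserDokchitser2011_rank_480a1_F5 :=
  DokchitserDokchitser2011_rank_480a1_F5_holds_of
    (DokchitserDokchitser2011_normDescent_480a1_quintic2651_of_normDescent_K h1 h2 h3 h4)

set_option backward.isDefEq.respectTransparency false in
/-- Likewise the rank leaf `DokchitserDokchitser2011_mordellWeilRank_480a1_F5` (`rk_ℤ E(F₅) = 1`)
from the four abstract quintic descents. [cite: DokchitserDokchitser2011RankModN, proof of Thm. 2] -/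
theorem DokchitserDokchitser2011_mordellWeilRank_480a1_F5_of_normDescent_K
    (h1 : ∀ {x y : CyclicQuintic2651K1.K}, y ^ 2 = x * (x + 2) * (x - 3) → y ≠ 0 →
      IsSquare (Algebra.norm ℚ x) → IsSquare (Algebra.norm ℚ (x + 2)) → IsSquare x ∧ IsSquare (x + 2))
    (h2 : ∀ {x y : CyclicQuintic2651K2.K}, y ^ 2 = x * (x + 2) * (x - 3) → y ≠ 0 →
      IsSquare (Algebra.norm ℚ x) → IsSquare (Algebra.norm ℚ (x + 2)) → IsSquare x ∧ IsSquare (x + 2))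
    (h3 : ∀ {x y : CyclicQuintic2651K3.K}, y ^ 2 = x * (x + 2) * (x - 3) → y ≠ 0 →
      IsSquare (Algebra.norm ℚ x) → IsSquare (Algebra.norm ℚ (x + 2)) → IsSquare x ∧ IsSquare (x + 2))
    (h4 : ∀ {x y : CyclicQuintic2651K4.K}, y ^ 2 = x * (x + 2) * (x - 3) → y ≠ 0 →
      IsSquare (Algebra.norm ℚ x) → IsSquare (Algebra.norm ℚ (x + 2)) → IsSquare x ∧ IsSquare (x + 2)) :
    DokchitserDokchitser2011_mordellWeilRank_480a1_F5 :=
  DokchitserDokchitser2011_mordellWeilRank_480a1_F5_holds_of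
    (DokchitserDokchitser2011_normDescent_480a1_quintic2651_of_normDescent_K h1 h2 h3 h4)

end Literature.Barriers.BirchSwinnertonDyer

end
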